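import Summits.AtomisticToContinuum.Crystallization.Theorems.PhononSlackCertificatesPeriodicGivenLayered

/-!
# Crux `TransitiveLocalLimit` (stmt-AtomisticToContinuum-15100), line `MotifTwo` — stub `stub_siteSum_const`

MOTIF-TWO INVERSION in layer-cake form: in a fault-free (`s (m + 1) = -s m`), equally spaced layered set
`S = {A (i u + j v + L(m) w + z(m) e₃)}` (`L = haggLabel s`, `A` a linear isometry, `a ∈ [47/50, 1]`, height
increments `≥ 39a/50`) all Lennard-Jones site sums `∑'_{q ∈ S, q ≠ p} V_LJ (dist p q)` are equal.

Proof. `LayeredHull.cake_siteEnergy` writes the site sum at a point of layer `m` as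
`Φ₀(a) + T m`, `T m := ∑'_{n} (if n = m then 0 else layerInteraction V_LJ a (z n − z m) (L n − L m) 1)`,
independent of the in-layer position. For a fault-free word the quantity `2 L n + s n` is constant in `n`
(`haggLabel_succ`), so `L (n + 1) − L (m + 1) = −(L n − L m)`; for arithmetic heights
`z (n + 1) − z (m + 1) = z n − z m`. Reindexing `n ↦ n + 1` (`Equiv.tsum_eq`, unconditional) and the evenness of
`layerInteraction` in the letter offset (`layerInteraction_neg_offset`) give `T (m + 1) = T m`, whence `T` is
constant by induction over `ℤ`.
-/

noncomputable section
namespace Summit.AtomisticToContinuum.Crystallization.Theorems.TransitiveLocalLimitMotifTwo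
open Filter
open Literature.MathematicalPhysics.StatisticalMechanics
open Summit.AtomisticToContinuum.Crystallization.Theorems.LayeredHull

/-- Fault-free label walks: if `s (m + 1) = -s m` for all `m`, then `2 L n + s n = s 0` for every `n`
(`L = haggLabel s`; the step `n ↦ n + 1` adds `2 s n` to `2 L n` and flips `s n`). [folklore] -/
theorem ssc_two_mul_haggLabel_add (s : ℤ → ℤ) (hfault : ∀ m : ℤ, s (m + 1) = -s m) (n : ℤ) :
    2 * haggLabel s n + s n = s 0 := by
  induction n using Int.induction_on with
  | zero => simp
  | succ k ih => rw [haggLabel_succ, hfault]; linarith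
  | pred k ih =>
    have h1 : haggLabel s (-(k : ℤ)) = haggLabel s (-(k : ℤ) - 1) + s (-(k : ℤ) - 1) := by
      rw [← haggLabel_succ, sub_add_cancel]
    have h2 : s (-(k : ℤ)) = -s (-(k : ℤ) - 1) := by
      rw [← hfault, sub_add_cancel]
    rw [h1, h2] at ih; linarith

/-- Fault-free label walks: the letter offset between layers `n + 1` and `m + 1` is minus the offset between
layers `n` and `m`. [folklore] -/
theorem ssc_haggLabel_succ_sub (s : ℤ → ℤ) (hfault : ∀ m : ℤ, s (m + 1) = -s m) (n m : ℤ) :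
    haggLabel s (n + 1) - haggLabel s (m + 1) = -(haggLabel s n - haggLabel s m) := by
  rw [haggLabel_succ, haggLabel_succ]
  have hn := ssc_two_mul_haggLabel_add s hfault n
  have hm := ssc_two_mul_haggLabel_add s hfault m
  linarith

/-- Arithmetic heights: if `z (m + 2) - z (m + 1) = z (m + 1) - z m` for all `m`, then all increments
`z (n + 1) - z n` equal `z 1 - z 0`. [folklore] -/
theorem ssc_height_sub_eq (z : ℤ → ℝ) (hconst : ∀ m : ℤ, z (m + 2) - z (m + 1) = z (m + 1) - z m) (n : ℤ) :
    z (n + 1) - z n = z 1 - z 0 := by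
  induction n using Int.induction_on with
  | zero => simp
  | succ k ih =>
    rw [← ih, show (k : ℤ) + 1 + 1 = k + 2 by ring]
    exact hconst k
  | pred k ih =>
    rw [← ih, sub_add_cancel]
    have h := hconst (-(k : ℤ) - 1)
    rw [show -(k : ℤ) - 1 + 2 = -k + 1 by ring, show -(k : ℤ) - 1 + 1 = -k by ring] at h
    exact h.symm

/-- Arithmetic heights: `z (n + 1) - z (m + 1) = z n - z m`. [folklore] -/
theorem ssc_height_succ_sub (z : ℤ → ℝ) (hconst : ∀ m : ℤ, z (m + 2) - z (m + 1) = z (m + 1) - z m)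
    (n m : ℤ) : z (n + 1) - z (m + 1) = z n - z m := by
  have hn := ssc_height_sub_eq z hconst n
  have hm := ssc_height_sub_eq z hconst m
  linarith

/-- The layer sum `T m := ∑'_{n} (if n = m then 0 else layerInteraction V a (z n − z m) (L n − L m) 1)` of a
fault-free, equally spaced layered set satisfies `T (m + 1) = T m` (reindex `n ↦ n + 1`; the letter offset
changes sign, which `layerInteraction_neg_offset` absorbs). [folklore] -/
theorem ssc_layerSum_succ (V : ℝ → ℝ) (a : ℝ) (s : ℤ → ℤ) (z : ℤ → ℝ)
    (hfault : ∀ m : ℤ, s (m + 1) = -s m) (hconst : ∀ m : ℤ, z (m + 2) - z (m + 1) = z (m + 1) - z m)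
    (m : ℤ) :
    (∑' n : ℤ, if n = m + 1 then (0 : ℝ) else
      layerInteraction V a (z n - z (m + 1)) (haggLabel s n - haggLabel s (m + 1)) 1) =
    ∑' n : ℤ, if n = m then (0 : ℝ) else
      layerInteraction V a (z n - z m) (haggLabel s n - haggLabel s m) 1 := by
  rw [← Equiv.tsum_eq (Equiv.addRight (1 : ℤ)) fun n : ℤ => if n = m + 1 then (0 : ℝ) else
    layerInteraction V a (z n - z (m + 1)) (haggLabel s n - haggLabel s (m + 1)) 1]
  refine tsum_congr fun n => ?_
  simp only [Equiv.coe_addRight, add_left_inj]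
  split_ifs with h
  · rfl
  · rw [ssc_height_succ_sub z hconst n m, ssc_haggLabel_succ_sub s hfault n m, layerInteraction_neg_offset]

/-- The layer sum `T m` of a fault-free, equally spaced layered set does not depend on the layer `m`.
[folklore] -/
theorem ssc_layerSum_const (V : ℝ → ℝ) (a : ℝ) (s : ℤ → ℤ) (z : ℤ → ℝ)
    (hfault : ∀ m : ℤ, s (m + 1) = -s m) (hconst : ∀ m : ℤ, z (m + 2) - z (m + 1) = z (m + 1) - z m)
    (m m' : ℤ) :
    (∑' n : ℤ, if n = m then (0 : ℝ) else
      layerInteraction V a (z n - z m) (haggLabel s n - haggLabel s m) 1) =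
    ∑' n : ℤ, if n = m' then (0 : ℝ) else
      layerInteraction V a (z n - z m') (haggLabel s n - haggLabel s m') 1 := by
  suffices H : ∀ k : ℤ, (∑' n : ℤ, if n = k then (0 : ℝ) else
      layerInteraction V a (z n - z k) (haggLabel s n - haggLabel s k) 1) =
    ∑' n : ℤ, if n = 0 then (0 : ℝ) else
      layerInteraction V a (z n - z 0) (haggLabel s n - haggLabel s 0) 1 by
    rw [H m, H m']
  intro k
  induction k using Int.induction_on with
  | zero => rfl
  | succ k ih => rw [ssc_layerSum_succ V a s z hfault hconst, ih]
  | pred k ih =>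
    rw [← ih, ← ssc_layerSum_succ V a s z hfault hconst (-(k : ℤ) - 1), sub_add_cancel]

/-- **STUB 3 — MOTIF-TWO INVERSION (layer-cake form)**: in a fault-free, equally spaced layered set all
Lennard-Jones site sums are equal. `cake_siteEnergy` writes the site sum of a point of layer `m` as
`Φ₀(a) + T m`, independent of the in-layer position, and `T` is constant (`ssc_layerSum_const`). [folklore] -/
theorem stub_siteSum_const : ∀ a : ℝ, 47 / 50 ≤ a → a ≤ 1 → ∀ (A : EuclideanSpace ℝ (Fin 3) →ₗᵢ[ℝ] EuclideanSpace ℝ (Fin 3)) (s : ℤ → ℤ) (z : ℤ → ℝ), (∀ m : ℤ, 39 / 50 * a ≤ z (m + 1) - z m) → (∀ m : ℤ, s (m + 1) = -s m) → (∀ m : ℤ, z (m + 2) - z (m + 1) = z (m + 1) - z m) → ∀ S : Set (EuclideanSpace ℝ (Fin 3)), S = {p : EuclideanSpace ℝ (Fin 3) | ∃ m i j : ℤ, p = A (((i : ℝ) • triangularVec₁ a) + ((j : ℝ) • triangularVec₂ a) + ((haggLabel s m : ℝ) • barlowOffset a) + (z m • layerNormal 1))} → ∀ p ∈ S, ∀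 p' ∈ S, (∑' q : {q : EuclideanSpace ℝ (Fin 3) // q ∈ S ∧ q ≠ p}, lennardJones (dist p (q : EuclideanSpace ℝ (Fin 3)))) = (∑' q : {q : EuclideanSpace ℝ (Fin 3) // q ∈ S ∧ q ≠ p'}, lennardJones (dist p' (q : EuclideanSpace ℝ (Fin 3)))) := by
  intro a ha ha1 A s z hz hfault hconst S hS
  subst hS
  rintro p ⟨m, i, j, rfl⟩ p' ⟨m', i', j', rfl⟩
  rw [cake_siteEnergy a ha ha1 A s z hz m i j, cake_siteEnergy a ha ha1 A s z hz m' i' j',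
    ssc_layerSum_const lennardJones a s z hfault hconst m m']

end Summit.AtomisticToContinuum.Crystallization.Theorems.TransitiveLocalLimitMotifTwo

end
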